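import Literature.Barriers.ValiantsHypothesis.NumericToSymbolicProp33
import Literature.Computability.AlgebraicComplexity.Elusive
import HarnessLib

/-!
# Non-elusiveness in symbolic form (Garg–Makam–Oliveira–Wigderson 2019, Lemma 9.3)

Topic `Literature/Computability/AlgebraicComplexity`. GMOW 2019, §9 recasts Raz's (numeric)
notion of an `(s, r)`-elusive polynomial map (`IsElusive`, `Elusive.lean`; GMOW Def. 9.1) through
their "numeric to symbolic" transfer: **Lemma 9.3** — if `L : Fⁿ → F^m` is NOT `(r, d)`-elusive,
then there are algebraic functions `p₁(z), …, p_r(z) ∈ \overline{F(z)}` with every coordinate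
`L_i ∈ d-span(p₁, …, p_r)` (Def. 9.2: the `F`-span of the monomials of degree `≤ d` in the `p_j`);
the printed proof is one line from Proposition 3.3 ("`im(L) ⊆ im(M)` … means, by Proposition 3.3,
that there exist `p_j ∈ \overline{F(z)}` with `L(z) = M(p(z))`; since each `M_i` is a degree-`d`
polynomial, `L_i ∈ d-span(p)`"). Proposition 3.3 is PROVED in the tree
(`Literature.Barriers.ValiantsHypothesis.GMOW2019_prop33_holds`), so Lemma 9.3 is proved here, in
the sharper intermediate form the proof actually gives (the degree-`≤ d` map `M` witnessing
non-elusiveness together with the symbolic solution `L(z) = M(p(z))`), from which span membership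
is immediate.

* `exists_aeval_eq_of_not_isElusive` — Lemma 9.3 for a general polynomial map over an
  algebraically closed field.
* `exists_aeval_eq_X_pow_of_not_isElusive` — the case of a monomial curve `x ↦ (x^{d_i})_i`
  (`σ = Fin 1`), the shape in which route `ValiantsHypothesis/GirthSidon` meets it: it turns the
  hypothesis of `Summit.ValiantsHypothesis.ValiantsHypothesis.Theses.GirthSidon.SwallowForcesShortRelation`
  (pointwise swallowing of a monomial curve by a quadratic map) into an identity
  `x^{d_i} = Γ_i(b₁(x), …, b_s(x))` over the algebraic closure of `ℂ(x)` — the first half of that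
  route's foreseen "PuiseuxTransfer" (the second half, Newton–Puiseux `\overline{ℂ(x)} ↪ ⋃_N ℂ((x^{1/N}))`,
  is not in Mathlib and not here).

Universe note: the tree's `GMOW2019_prop33` quantifies over `F σ τ ι : Type`, so the statements
below live in `Type` (enough for `ℂ`, `Fin n`).

## References

* [GargMakamOliveiraWigderson2019] A. Garg, V. Makam, R. Oliveira, A. Wigderson, *More barriers
  for rank methods, via a "numeric to symbolic" transfer*, FOCS 2019 (arXiv:1904.04299): §9,
  Def. 9.1, Def. 9.2, Lemma 9.3 and its proof, Remark 9.4; Prop. 3.3. Held text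
  `paper:arxiv-1904.04299`, chunk p0024.
* [Raz2010] R. Raz, *Elusive functions and lower bounds for arithmetic circuits*, Theory of
  Computing 6 (2010), Def. 1.1.
-/

noncomputable section

namespace Literature.Computability.AlgebraicComplexity

open MvPolynomial

/-- **Garg–Makam–Oliveira–Wigderson 2019, Lemma 9.3** (symbolic form of non-elusiveness, via
Prop. 3.3): over an algebraically closed field `F`, if a polynomial map `f : F^σ → F^ι` (finitely
many variables and coordinates) is not `(s, r)`-elusive, then there are a polynomial map
`Γ : F^s → F^ι` of degree `≤ r` and algebraic functions `b₁, …, b_s ∈ \overline{F(z)}` with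
`f_i(z) = Γ_i(b₁(z), …, b_s(z))` for every `i` — so each `f_i` lies in the degree-`r` span of
`b₁, …, b_s` (Def. 9.2). [cite: GargMakamOliveiraWigderson2019, Lemma 9.3] -/
theorem exists_aeval_eq_of_not_isElusive {F : Type} [Field F] [IsAlgClosed F] {σ ι : Type}
    [Finite σ] [Finite ι] {f : ι → MvPolynomial σ F} {s r : ℕ} (h : ¬ IsElusive f s r) :
    ∃ (Γ : ι → MvPolynomial (Fin s) F)
      (b : Fin s → AlgebraicClosure (FractionRing (MvPolynomial σ F))),
      (∀ i, (Γ i).totalDegree ≤ r) ∧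
        ∀ i, algebraMap (MvPolynomial σ F) (AlgebraicClosure (FractionRing (MvPolynomial σ F)))
          (f i) = aeval b (Γ i) := by
  classical
  unfold IsElusive at h
  push Not at h
  obtain ⟨Γ, hΓ, hsub⟩ := h
  have hLM : ∀ β : σ → F, ∃ γ : Fin s → F, ∀ i, eval β (f i) = eval γ (Γ i) := by
    intro β
    obtain ⟨γ, hγ⟩ := hsub ⟨β, rfl⟩
    exact ⟨γ, fun i => by simpa [polyMapEval] using (congr_fun hγ i).symm⟩
  obtain ⟨b, hb⟩ :=
    Literature.Barriers.ValiantsHypothesis.GMOW2019_prop33_holds F σ (Fin s) ι f Γ hLM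
  exact ⟨Γ, b, hΓ, hb⟩

/-- **GMOW 2019, Lemma 9.3 for monomial curves** (the case `σ = Fin 1`, `f_i = x^{d_i}`, any
field of definition that is algebraically closed, e.g. `ℂ`): if the monomial curve
`x ↦ (x^{d_i})_{i ∈ ι}` is not `(s, r)`-elusive, then `x^{d_i} = Γ_i(b₁(x), …, b_s(x))` in
`\overline{F(x)}` for some degree-`≤ r` map `Γ` and algebraic functions `b_j` — the symbolic
form in which GMOW §9 (Prop. 9.8) and route GirthSidon study swallowed monomial curves.
[cite: GargMakamOliveiraWigderson2019, Lemma 9.3 and §9 (Prop. 9.8)] -/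
theorem exists_aeval_eq_X_pow_of_not_isElusive {F : Type} [Field F] [IsAlgClosed F] {ι : Type}
    [Finite ι] (d : ι → ℕ) {s r : ℕ}
    (h : ¬ IsElusive (fun i => (X 0 : MvPolynomial (Fin 1) F) ^ d i) s r) :
    ∃ (Γ : ι → MvPolynomial (Fin s) F)
      (b : Fin s → AlgebraicClosure (FractionRing (MvPolynomial (Fin 1) F))),
      (∀ i, (Γ i).totalDegree ≤ r) ∧
        ∀ i, (algebraMap (MvPolynomial (Fin 1) F)
          (AlgebraicClosure (FractionRing (MvPolynomial (Fin 1) F))) (X 0)) ^ d i =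
            aeval b (Γ i) := by
  obtain ⟨Γ, b, hΓ, hb⟩ := exists_aeval_eq_of_not_isElusive h
  exact ⟨Γ, b, hΓ, fun i => by simpa [map_pow] using hb i⟩

end Literature.Computability.AlgebraicComplexity

end
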